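import Literature.RingTheory.KrullDimension.HomogeneousCommonZero
import Literature.RingTheory.MvPolynomial.HomogeneousDimension
import HarnessLib

/-!
# A homogeneous ideal of height `< N` in `k[X₁, …, X_N]` has a non-trivial zero

Topic `Literature/RingTheory/KrullDimension`, continuing `HomogeneousCommonZero.lean` (there: the
special case of an ideal generated by `m < N` polynomials without constant term, via Krull's
height theorem).  Here the hypothesis is on the HEIGHT of the ideal directly: over an algebraically
closed field `k`, **a homogeneous ideal `I ⊆ k[X₁, …, X_N]` with `height I < N` has a common zero
`x ≠ 0`** (`exists_ne_zero_common_zero_of_isHomogeneous_of_height_lt`) — the affine-cone form of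
"a projective variety of dimension `≥ 0` is non-empty" (Hartshorne I, Ex. 2.2 / proof of Thm. 7.2;
Matsumura, *Commutative Ring Theory*, §13–14 for heights), which is how height bounds such as
Eagon–Northcott's (`VonZurGathenRegularityProofs.lean`) or Alper–Bogart–Velasco's
`codim Sing(det L) ≤ 4` (`ABV17SingularLocusBound.lean`) are turned into points.

Proof: `height I = ⨅` over the minimal primes of `I`, so some minimal prime `P` has
`height P < N`; minimal primes of a homogeneous ideal are homogeneous
(`isHomogeneous_of_mem_minimalPrimes`), hence `P` lies in the irrelevant ideal `𝔪₀`
(`le_ker_constantCoeff_of_isHomogeneous`), whose height is `N` (`height_ker_constantCoeff`), so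
`P ≠ 𝔪₀`; by the Nullstellensatz (`MvPolynomial.IsPrime.vanishingIdeal_zeroLocus`) the zero set
of the prime `P` is not contained in `{0}`.

## References

* R. Hartshorne, *Algebraic Geometry*, GTM 52, I Thm. 7.2 and Ex. 2.2 (projective dimension
  theorem; the cone over a projective variety). [Hartshorne1977]
* H. Matsumura, *Commutative Ring Theory*, Thm. 13.5 (Krull), §14 (systems of parameters).
  [Matsumura1987]
-/

noncomputable section

open MvPolynomial

namespace Literature.RingTheory.KrullDimension

universe u

variable {k : Type u} [Field k]

/-- **A homogeneous ideal of height `< N` in `N` variables over an algebraically closed field has a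
common zero other than the origin.**  (`Ideal.IsHomogeneous` for the grading by total degree,
`MvPolynomial.homogeneousSubmodule`; the grading instance `MvPolynomial.gradedAlgebra` is supplied
explicitly since Mathlib keeps it local.)  Minimal primes of a homogeneous ideal are homogeneous, so
one of height `< N = height (X₁, …, X_N)` is a prime strictly inside the irrelevant ideal, and its
zero set is not `{0}` by the Nullstellensatz. [cite: Hartshorne1977, I Thm. 7.2 and Ex. 2.2] -/
theorem exists_ne_zero_common_zero_of_isHomogeneous_of_height_lt [IsAlgClosed k] {N : ℕ}
    (I : Ideal (MvPolynomial (Fin N) k))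
    (hI : letI : GradedAlgebra (homogeneousSubmodule (Fin N) k) := MvPolynomial.gradedAlgebra
      I.IsHomogeneous (homogeneousSubmodule (Fin N) k))
    (hlt : I.height < N) :
    ∃ x : Fin N → k, x ≠ 0 ∧ ∀ p ∈ I, MvPolynomial.eval x p = 0 := by
  classical
  letI : GradedAlgebra (homogeneousSubmodule (Fin N) k) := MvPolynomial.gradedAlgebra
  -- a minimal prime of height `< N`
  have hJ : ∃ J ∈ I.minimalPrimes, J.height < N := by
    by_contra hcon
    push Not at hcon
    have hge : (N : ℕ∞) ≤ I.height := by
      rw [Ideal.height_eq_inf_minimalPrimes]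
      exact le_iInf₂ hcon
    exact absurd hlt (not_lt.2 hge)
  obtain ⟨J, hJmin, hJlt⟩ := hJ
  haveI hJprime : J.IsPrime := hJmin.1.1
  set m₀ : Ideal (MvPolynomial (Fin N) k) :=
    RingHom.ker (constantCoeff : MvPolynomial (Fin N) k →+* k) with hm₀
  -- it is homogeneous, hence inside the irrelevant ideal, and not equal to it
  have hJhom := Literature.RingTheory.MvPolynomial.isHomogeneous_of_mem_minimalPrimes hI hJmin
  have hJle : J ≤ m₀ :=
    Literature.RingTheory.MvPolynomial.le_ker_constantCoeff_of_isHomogeneous hJhom hJprime.ne_top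
  have hJne : J ≠ m₀ := by
    intro h
    rw [h, hm₀, height_ker_constantCoeff] at hJlt
    exact lt_irrefl _ hJlt
  -- Nullstellensatz
  have hnot : ¬ (zeroLocus k J ⊆ ({0} : Set (Fin N → k))) := by
    intro hsub
    apply hJne (le_antisymm hJle ?_)
    have h1 : vanishingIdeal k ({0} : Set (Fin N → k)) ≤ vanishingIdeal k (zeroLocus k J) :=
      vanishingIdeal_anti_mono hsub
    rw [IsPrime.vanishingIdeal_zeroLocus] at h1
    refine le_trans (fun p hp => ?_) h1
    rw [mem_vanishingIdeal_iff]
    intro x hx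
    rw [Set.mem_singleton_iff.1 hx, aeval_zero, Algebra.algebraMap_self_apply]
    exact (RingHom.mem_ker).1 hp
  obtain ⟨x, hxJ, hx0⟩ := Set.not_subset.1 hnot
  refine ⟨x, hx0, fun p hp => ?_⟩
  have h := (mem_zeroLocus_iff.1 hxJ) p (hJmin.1.2 hp)
  rwa [aeval_eq_eval] at h

/-- The same for an ideal spanned by homogeneous polynomials of arbitrary degrees: if
`height (span S) < N` then the elements of `S` have a common non-trivial zero. [cite: Hartshorne1977, I Thm. 7.2 and Ex. 2.2] -/
theorem exists_ne_zero_common_zero_of_span_isHomogeneous_of_height_lt [IsAlgClosed k] {N : ℕ}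
    (S : Set (MvPolynomial (Fin N) k)) (hS : ∀ p ∈ S, ∃ d, p.IsHomogeneous d)
    (hlt : (Ideal.span S).height < N) :
    ∃ x : Fin N → k, x ≠ 0 ∧ ∀ p ∈ S, MvPolynomial.eval x p = 0 := by
  classical
  letI : GradedAlgebra (homogeneousSubmodule (Fin N) k) := MvPolynomial.gradedAlgebra
  have hI : (Ideal.span S).IsHomogeneous (homogeneousSubmodule (Fin N) k) := by
    refine Ideal.homogeneous_span (𝒜 := homogeneousSubmodule (Fin N) k) _ fun p hp => ?_
    obtain ⟨d, hd⟩ := hS p hp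
    exact ⟨d, (mem_homogeneousSubmodule d p).2 hd⟩
  obtain ⟨x, hx0, hx⟩ := exists_ne_zero_common_zero_of_isHomogeneous_of_height_lt _ hI hlt
  exact ⟨x, hx0, fun p hp => hx p (Ideal.subset_span hp)⟩

end Literature.RingTheory.KrullDimension

end
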